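import Summits.PneNP.PneNP.Theorems.ConvexRankGatesCliqueExtLowerBoundConvCalibrationR6

/-!
# Pair-form sandwichability at every level implies the CNF-side form (reshape r7, converse)
(crux `CliqueExtLowerBound`, stmt-PneNP-10682; line `width-threshold-certificate-sparsity`, lead c9)

`…CnfSide.lean` (`sandwichable_of_cnfSide`) showed that the DNF tuple of `Sandwichable` is idle: the
CNF-side-only form implies the pair form. This file proves the CONVERSE for every gate class
`Q c m φ` monotone in the level `c`: if the gates of `Q c` are `(r,s)`-sandwichable with children budget
`m^(c+3)` and error `eps m c` at EVERY level `c` (eventually in `m`, for all large `r, s`), then they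
satisfy the CNF-side form at every level `c`.

Proof (`cnfSide_of_sandwichable`). Fix `c` and use the hypothesis at level `c+1` (error
`eps m (c+1) = eps m c / m`, budget `m^(c+4)`, class `Q (c+1) ⊇ Q c`). Given `≤ m^(c+3)` distinct
`s`-local CNF children `C j`, SWITCH every `s`-local CNF `κ` once (Jukna 2012, Lemma 9.15,
`monotoneSwitching_cnf`): an `(r-1)`-DNF `sw κ ≤ κ` and an exact `r`-DNF `Dx κ` with `≤ (s-1)^r`
monomials and `κ ≤ sw κ ∨ Dx κ`. The legal local pairs `(sw (C j), C j)` number `≤ m^(c+3)`, so the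
hypothesis gives a pair `dnf ≤ cnf`. Negatives: same predicate, smaller error. Positives: where
`φ (cval C x) ≠ φ (dval D x)` some child has `C j x ∧ ¬ sw (C j) x`, hence `Dx (C j) x`; by the mass
lemma `card_filter_evalDNF_cliqueVec_mul_pow_le` (Jukna 2012, Thm 9.26, Case 1) with `Q = k = ⌈m^{1/4}⌉₊`
and `d = 4(2c+5)` the union over the `≤ m^(c+3)` children costs `≤ #P / (16 m^(c+1))`, and
`eps m (c+1) + 1/(16 m^(c+1)) ≤ eps m c` for `m ≥ 2`.

References: S. Jukna, *Boolean Function Complexity* (2012), Lemma 9.15, Thm 9.17, Thm 9.26 [Jukna2012].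
-/

set_option linter.dupNamespace false

open Literature.Computability.Complexity Filter Finset
open Summit.PneNP.PneNP.Theorems.CliqueExtLowerBound.WidthThreshold

noncomputable section

namespace Summit.PneNP.PneNP.Theorems.CliqueExtLowerBound.WidthThreshold.CnfSideConverse

/-- Positive-side numerics of the converse: `16 m^{c+1} · m^{c+3} (s-1)^r ≤ k^{4(2c+5)}` once
`m ≤ k^4` and `16 (s-1)^r ≤ m`. [folklore] -/
theorem pos_numerics {m k c r s : ℕ} (hk : m ≤ k ^ 4) (hm : 16 * (s - 1) ^ r ≤ m) :
    16 * m ^ (c + 1) * (m ^ (c + 3) * (s - 1) ^ r) ≤ k ^ (4 * (2 * c + 5)) := by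
  calc 16 * m ^ (c + 1) * (m ^ (c + 3) * (s - 1) ^ r) = m ^ (2 * c + 4) * (16 * (s - 1) ^ r) := by ring
    _ ≤ m ^ (2 * c + 4) * m := Nat.mul_le_mul_left _ hm
    _ = m ^ (2 * c + 5) := by ring
    _ ≤ (k ^ 4) ^ (2 * c + 5) := Nat.pow_le_pow_left hk _
    _ = k ^ (4 * (2 * c + 5)) := by rw [← pow_mul]

/-- The two error budgets of the converse add up: `eps m (c+1) + 1/(16 m^{c+1}) ≤ eps m c` for `m ≥ 2`.
[folklore] -/
theorem eps_succ_add_le {m c : ℕ} (hm : 2 ≤ m) :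
    eps m (c + 1) + 1 / (16 * (m : ℝ) ^ (c + 1)) ≤ eps m c := by
  have hm' : (2 : ℝ) ≤ m := by exact_mod_cast hm
  have hpos : (0 : ℝ) < (m : ℝ) ^ (c + 1) := by positivity
  have h1 : eps m (c + 1) ≤ 1 / (16 * (m : ℝ) ^ (c + 1)) := by
    unfold eps
    apply one_div_le_one_div_of_le (by positivity)
    calc 16 * (m : ℝ) ^ (c + 1) = 8 * (m : ℝ) ^ (c + 1) * 2 := by ring
      _ ≤ 8 * (m : ℝ) ^ (c + 1) * m := by gcongr
      _ = 8 * (m : ℝ) ^ (c + 1 + 1) := by ring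
  calc eps m (c + 1) + 1 / (16 * (m : ℝ) ^ (c + 1))
      ≤ 1 / (16 * (m : ℝ) ^ (c + 1)) + 1 / (16 * (m : ℝ) ^ (c + 1)) := by gcongr
    _ = eps m c := by unfold eps; field_simp; ring

/-- The error budget decreases with the level: `eps m (c+1) ≤ eps m c` for `m ≥ 1`. [folklore] -/
theorem eps_succ_le {m c : ℕ} (hm : 1 ≤ m) : eps m (c + 1) ≤ eps m c := by
  have hm' : (1 : ℝ) ≤ m := by exact_mod_cast hm
  unfold eps
  apply one_div_le_one_div_of_le (by positivity)
  exact mul_le_mul_of_nonneg_left (pow_le_pow_right₀ hm' (by omega)) (by norm_num)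

open Classical in
/-- **Pair form at every level ⇒ CNF-side form at every level (REGISTERED `cnfSide_of_sandwichable`).**
For a gate class `Q c m φ` monotone in the level `c`: if eventually every gate of `Q c` is
`(r,s)`-sandwichable with children from `≤ m^(c+3)` distinct legal local pairs and error `eps m c`, then
eventually every gate of `Q c`, composed with `≤ m^(c+3)` distinct `s`-local CNFs `C j` of the edges, has
a legal local pair `dnf ≤ cnf` losing `≤ eps m c · #P` of the positives accepted by `φ ∘ cval C` and
accepting `≤ eps m c · #N` of the negatives rejected by it (level `c+1` of the hypothesis, one switching
`monotoneSwitching_cnf` per distinct child, exact monomials charged on the positives by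
`card_filter_evalDNF_cliqueVec_mul_pow_le`). [cite: Jukna2012, Lemma 9.15 and Thm. 9.26] -/
theorem cnfSide_of_sandwichable :
    ∀ Q : ℕ → ℕ → GateFn → Prop, (∀ c m φ, Q c m φ → Q (c + 1) m φ) →
    (∀ c : ℕ, ∃ r₀ s₀ : ℕ, 2 ≤ r₀ ∧ 2 ≤ s₀ ∧ ∀ r s : ℕ, r₀ ≤ r → s₀ ≤ s →
      ∀ᶠ m : ℕ in atTop, ∀ φ : GateFn, Q c m φ →
        Sandwichable r s (m ^ (c + 3)) (posFam m) (negFam m) (eps m c) φ) →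
    ∀ c : ℕ, ∃ r₀ s₀ : ℕ, 2 ≤ r₀ ∧ 2 ≤ s₀ ∧ ∀ r s : ℕ, r₀ ≤ r → s₀ ≤ s →
      ∀ᶠ m : ℕ in atTop, ∀ φ : GateFn, Q c m φ →
        ∀ C : Fin φ.1 → Finset (Finset (EV m)),
          #(univ.image C) ≤ m ^ (c + 3) → (∀ j, IsLocal s (C j)) →
          ∃ dnf cnf : Finset (Finset (EV m)), IsLocal r dnf ∧ IsLocal s cnf ∧
            (∀ x, EvalDNF dnf x → EvalCNF cnf x) ∧
            (#((posFam m).filter fun x => φ.2 (cval C x) = true ∧ ¬ EvalDNF dnf x) : ℝ)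
              ≤ eps m c * #(posFam m) ∧
            (#((negFam m).filter fun x => EvalCNF cnf x ∧ φ.2 (cval C x) = false) : ℝ)
              ≤ eps m c * #(negFam m) := by
  intro Q hQ hS c
  obtain ⟨r₀, s₀, hr₀, hs₀, h⟩ := hS (c + 1)
  refine ⟨r₀ + (4 * (2 * c + 5)).choose 2 + 1, s₀, by omega, hs₀, fun r s hr hs => ?_⟩
  filter_upwards [h r s (by omega) hs, eventually_ge_atTop 17,
    eventually_ge_atTop (16 * (s - 1) ^ r)] with m hm hm17 hmP
  intro φ hφ C hA hC
  -- switch every `s`-local CNF once (Jukna 2012, Lemma 9.15)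
  choose! sw Dx hsw1 hsw2 hsw3 hsw4 hsw5 using
    fun (κ : Finset (Finset (EV m))) (hκ : ∀ S ∈ κ, #S ≤ s - 1) => monotoneSwitching_cnf κ s r hκ
  -- the legal local child pairs `(sw (C j), C j)` and the hypothesis at level `c + 1`
  have hbudget : #(univ.image fun j => (sw (C j), C j)) ≤ m ^ (c + 1 + 3) := by
    have himg : (univ.image fun j => (sw (C j), C j)) = (univ.image C).image fun κ => (sw κ, κ) := by
      rw [image_image]; rfl
    rw [himg]
    exact card_image_le.trans (hA.trans (Nat.pow_le_pow_right (by omega) (by omega)))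
  obtain ⟨dnf, cnf, h1, h2, h3, h4, h5⟩ := hm φ (hQ c m φ hφ) (fun j => sw (C j)) C hbudget
    (fun j => hsw1 (C j) (hC j)) hC (fun j => hsw4 (C j) (hC j))
  refine ⟨dnf, cnf, h1, h2, h3, ?_, h5.trans (mul_le_mul_of_nonneg_right (eps_succ_le (by omega))
    (Nat.cast_nonneg _))⟩
  -- positives
  have hk4 : m ≤ kk m ^ 4 := Inline.le_ceil_pow_four m
  have hk1 : (kk m - 1) ^ 4 < m := Inline.ceil_sub_one_pow_four_lt (by omega)
  have hk3 : 3 ≤ kk m := by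
    by_contra hlt
    have : kk m ^ 4 ≤ 2 ^ 4 := Nat.pow_le_pow_left (by omega) 4
    omega
  have hkk : kk m * kk m ≤ m := by
    have h2 : kk m ≤ (kk m - 1) * (kk m - 1) :=
      calc kk m ≤ 2 * (kk m - 1) := by omega
        _ ≤ (kk m - 1) * (kk m - 1) := Nat.mul_le_mul_right _ (by omega)
    calc kk m * kk m ≤ ((kk m - 1) * (kk m - 1)) * ((kk m - 1) * (kk m - 1)) := Nat.mul_le_mul h2 h2
      _ = (kk m - 1) ^ 4 := by ring
      _ ≤ m := hk1.le
  have hP : #(posFam m) = m.choose (kk m) := Inline.card_posGraphs (by omega)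
  -- mass of the exact monomials of one switched child on the positives
  have key : ∀ κ ∈ univ.image C,
      #((posFam m).filter fun x => EvalDNF (Dx κ) x) * kk m ^ (4 * (2 * c + 5)) ≤
        (s - 1) ^ r * m.choose (kk m) := by
    intro κ hκ
    obtain ⟨j, -, rfl⟩ := mem_image.1 hκ
    have hDx : ∀ R ∈ Dx (C j), (4 * (2 * c + 5)).choose 2 < #R := fun R hR => by
      rw [hsw2 (C j) (hC j) R hR]; omega
    calc #((posFam m).filter fun x => EvalDNF (Dx (C j)) x) * kk m ^ (4 * (2 * c + 5))
        ≤ #((powersetCard (kk m) (univ : Finset (Fin m))).filter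
            fun K => EvalDNF (Dx (C j)) (cliqueVec K)) * kk m ^ (4 * (2 * c + 5)) := by
          refine Nat.mul_le_mul_right _ ?_
          calc _ ≤ #(((powersetCard (kk m) univ).filter
                fun K => EvalDNF (Dx (C j)) (cliqueVec K)).image cliqueVec) := by
                refine card_le_card fun x hx => ?_
                rw [mem_filter] at hx
                obtain ⟨K, hK, rfl⟩ := mem_image.1 hx.1
                exact mem_image.2 ⟨K, mem_filter.2 ⟨hK, hx.2⟩, rfl⟩
            _ ≤ _ := card_image_le
      _ ≤ #(Dx (C j)) * m.choose (kk m) :=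
          card_filter_evalDNF_cliqueVec_mul_pow_le (by omega) hkk (Dx (C j)) hDx
      _ ≤ (s - 1) ^ r * m.choose (kk m) := Nat.mul_le_mul_right _ (hsw3 (C j) (hC j))
  -- the union over the distinct children
  set S₂ : Finset (EV m → Bool) :=
    (univ.image C).biUnion fun κ => (posFam m).filter fun x => EvalDNF (Dx κ) x with hS₂
  have hS₂card : #S₂ * kk m ^ (4 * (2 * c + 5)) ≤ m ^ (c + 3) * (s - 1) ^ r * m.choose (kk m) := by
    have hQpos : 0 < kk m ^ (4 * (2 * c + 5)) := Nat.pow_pos (by omega)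
    calc #S₂ * kk m ^ (4 * (2 * c + 5))
        ≤ #(univ.image C) * ((s - 1) ^ r * m.choose (kk m) / kk m ^ (4 * (2 * c + 5))) *
            kk m ^ (4 * (2 * c + 5)) :=
          Nat.mul_le_mul_right _ (card_biUnion_le_card_mul _ _ _ fun κ hκ =>
            (Nat.le_div_iff_mul_le hQpos).2 (key κ hκ))
      _ = #(univ.image C) * ((s - 1) ^ r * m.choose (kk m) / kk m ^ (4 * (2 * c + 5)) *
            kk m ^ (4 * (2 * c + 5))) := by ring
      _ ≤ #(univ.image C) * ((s - 1) ^ r * m.choose (kk m)) :=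
          Nat.mul_le_mul_left _ (Nat.div_mul_le_self _ _)
      _ ≤ m ^ (c + 3) * ((s - 1) ^ r * m.choose (kk m)) := Nat.mul_le_mul_right _ hA
      _ = _ := by ring
  have hS₂bound : #S₂ * (16 * m ^ (c + 1)) ≤ #(posFam m) := by
    rw [hP]
    exact Inline.mul_le_of_mul_le_mul hS₂card (pos_numerics hk4 hmP) (Nat.pow_pos (by omega))
  have hS₂real : (#S₂ : ℝ) ≤ 1 / (16 * (m : ℝ) ^ (c + 1)) * #(posFam m) := by
    have hpos : (0 : ℝ) < 16 * (m : ℝ) ^ (c + 1) := by positivity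
    rw [one_div, ← div_eq_inv_mul, le_div_iff₀ hpos]
    exact_mod_cast hS₂bound
  -- the positive error set splits along `φ (dval D x)`
  have hsub : ((posFam m).filter fun x => φ.2 (cval C x) = true ∧ ¬ EvalDNF dnf x) ⊆
      ((posFam m).filter fun x => φ.2 (dval (fun j => sw (C j)) x) = true ∧ ¬ EvalDNF dnf x) ∪ S₂ := by
    intro x hx
    rw [mem_filter] at hx
    rw [mem_union, mem_filter]
    by_cases hdx : φ.2 (dval (fun j => sw (C j)) x) = true
    · exact Or.inl ⟨hx.1, hdx, hx.2.2⟩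
    · right
      have hne : dval (fun j => sw (C j)) x ≠ cval C x := fun heq => hdx (by rw [heq]; exact hx.2.1)
      obtain ⟨j, hj⟩ := Function.ne_iff.1 hne
      have hCj : EvalCNF (C j) x ∧ ¬ EvalDNF (sw (C j)) x := by
        by_cases hd : EvalDNF (sw (C j)) x
        · exact absurd (show dval (fun j => sw (C j)) x j = cval C x j by
            simp only [dval, cval, decide_eq_decide]; exact iff_of_true hd (hsw4 (C j) (hC j) x hd)) hj
        · by_cases hc : EvalCNF (C j) x
          · exact ⟨hc, hd⟩
          · exact absurd (show dval (fun j => sw (C j)) x j = cval C x j by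
              simp only [dval, cval, decide_eq_decide]; exact iff_of_false hd hc) hj
      have hDxj : EvalDNF (Dx (C j)) x := ((hsw5 (C j) (hC j) x hCj.1).resolve_left hCj.2)
      rw [hS₂, mem_biUnion]
      exact ⟨C j, mem_image.2 ⟨j, mem_univ _, rfl⟩, mem_filter.2 ⟨hx.1, hDxj⟩⟩
  have hcard := (card_le_card hsub).trans (card_union_le _ _)
  calc (#((posFam m).filter fun x => φ.2 (cval C x) = true ∧ ¬ EvalDNF dnf x) : ℝ)
      ≤ #((posFam m).filter fun x => φ.2 (dval (fun j => sw (C j)) x) = true ∧ ¬ EvalDNF dnf x) + #S₂ := by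
        exact_mod_cast hcard
    _ ≤ eps m (c + 1) * #(posFam m) + 1 / (16 * (m : ℝ) ^ (c + 1)) * #(posFam m) := add_le_add h4 hS₂real
    _ = (eps m (c + 1) + 1 / (16 * (m : ℝ) ^ (c + 1))) * #(posFam m) := by ring
    _ ≤ eps m c * #(posFam m) :=
        mul_le_mul_of_nonneg_right (eps_succ_add_le (by omega)) (Nat.cast_nonneg _)

end Summit.PneNP.PneNP.Theorems.CliqueExtLowerBound.WidthThreshold.CnfSideConverse

end
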